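import Literature.Probability.Percolation.WiredMinimalSpanningForest
import Literature.Probability.Percolation.SlabUniqueness
import Literature.Barriers.CriticalPhenomena.SubexponentialGrowthZdFMSF
import HarnessLib

/-!
# Newman–Tassion–Wu 2017, Theorem 2.4: the minimal spanning forest of a slab is a single tree
# (statement layer: the theorem and its §4 reduction target as named facts)

Topic: `Literature/Probability/Percolation`. Statement layer of the MAIN theorem of Newman–Tassion–Wu,
*Critical percolation and the minimal spanning tree in slabs* (CPAM 70 (2017); arXiv:1512.09107, §2.4
and §4), in the tree's vocabulary:

* the slab `S_k = ℤ² × {0,…,k}` is `slab 3 k = {x ∈ ℤ³ : 0 ≤ x₀ ≤ k}` with its induced bond graph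
  `slabGraph 3 k` (`HalfSpace.lean`; locally finite by `instLocallyFiniteInduce`, `SlabUniqueness.lean`);
* the label space `Ω = [0,1]^E` with "the underlying (product of uniforms) probability measure"
  (NTW §2.3) is `labelMeasure (slab 3 k) = Measure.infinitePi (fun _ => vol|_{[0,1]})` on
  `Sym2 (slab 3 k) → ℝ` (`Percolation.lean`, the monotone coupling; coordinates outside the edge set
  are immaterial);
* the wired minimal spanning forest `𝔉_w(U)` is `wmsf (slabGraph 3 k) U` (Lyons–Peres–Schramm's
  finite-cut form, `WiredMinimalSpanningForest.lean`; it is `𝔉_w(U)` for injective labels, i.e.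
  almost surely), the free one `𝔉_f(U)` is `Literature.Barriers.CriticalPhenomena.fmsf E(S_k) U`
  (`SubexponentialGrowthZdFMSF.lean`);
* the invasion cluster / tree of a vertex `v` (NTW §2.2) has vertex set
  `Invasion.invadedRegion (slabGraph 3 k) U v` (`InvasionPercolation.lean`; NTW: "`𝓘_v` has the same
  vertices as `T_v`").

Contents (definitions of `Prop`s only — NAMED FACTS; no proof is claimed here):

* `NewmanTassionWu2017_thm24` — **Theorem 2.4** in the WMSF form: for every `k ≥ 1`, for
  `labelMeasure`-a.e. `U`, the graph on `S_k` with edge set `𝔉_w(U)` is connected ("a single tree":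
  every vertex of `S_k` lies in the forest because all its components are infinite, NTW §2.1, so
  "single tree" is "any two vertices of `S_k` are joined inside `𝔉_w(U)`"; acyclicity is not part of
  the claim being named — it holds for every injective `U`).
* `NewmanTassionWu2017_thm24_free` — the paper-literal reading "the minimal spanning forest on `S_k`"
  (NTW p. 5: on `S_k` "WMSF and FMSF coincide. This justifies referring to the minimal spanning forest
  on `S_k` without ambiguity"): a.s. `𝔉_w(U) = 𝔉_f(U)` and it is a single tree.
* `NewmanTassionWu2017_invasionMeet` — the statement §4 actually proves (NTW §2.4, proof sketch:
  "By Proposition 2.3, it suffices to prove that for any `x ∈ S_k`, `𝓘_0 ∩ 𝓘_x ≠ ∅`"; §4 proves that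
  a.s. some open circuit `Γ^{(i)}` has all its vertices in `𝓘_0 ∩ 𝓘_x`): for every `k ≥ 1` and every
  vertex `x`, a.s. the invaded regions of the origin and of `x` share a vertex.

Design notes.  (1) The paper states Theorem 2.4 "for any `k ∈ ℕ`"; its proof (§3–§4) is written for
the slabs `S_k`, `k ≥ 1` ("for every fixed `k ≥ 1`", §3), the case `k = 0` being the planar theorem of
Chayes–Chayes–Newman 1985 / Alexander–Molchanov.  We name the slab statement `k ≥ 1`, which is what
§4 proves on top of Theorem 3.1 (`NewmanTassionWu2017_thm31`, in tree and discharged).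
-- TODO(general form): `k = 0` (the MSF of `ℤ²` is a tree, [CCN85]) is not named here.
(2) The reduction "invasion clusters meet ⇒ single tree" is LPS 2006 Prop. 3.3 / Thm 3.12
(tree: `Summits/…/PercNearOneGluingNoHeavyRsw3InvasionTreesDichotomy.lean`,
`wmsf_reachable_of_common_vertex`, for injective labels, which are a.s.); it is NOT restated here.
(3) NTW's Remark (the same for `ℤ² × F`, `F` finite connected, and for finite-range `ℤ²`) is out of
scope.  (4) Nothing here depends on `θ(p_c) = 0` for `ℤ³`.

## Sources

* C. M. Newman, V. Tassion, W. Wu, *Critical percolation and the minimal spanning tree in slabs*,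
  Comm. Pure Appl. Math. 70 (2017) 2084–2120, arXiv:1512.09107: §2.1 (MSF/FMSF/WMSF, Prop. 2.2),
  §2.2 (invasion, Prop. 2.3), §2.3 (`Ω = [0,1]^E`, product of uniforms), §2.4 Theorem 2.4 and the
  proof sketch, §4 (pp. 5–7, 19–21 of the arXiv text) [NewmanTassionWu2017].
* R. Lyons, Y. Peres, O. Schramm, *Minimal spanning forests*, Ann. Probab. 34 (2006), §3
  [LyonsPeresSchramm2006] (the finite-cut form of `𝔉_w`).
-/

noncomputable section

namespace Literature.Probability.Percolation

open _root_.MeasureTheory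

/-- NAMED FACT — **Newman–Tassion–Wu 2017, Theorem 2.4 (the minimal spanning forest of a slab is a
single tree)**, WMSF form: "For any `k`, the minimal spanning forest on `S_k = ℤ² × {0,…,k}` is a
single tree a.s." — here for every `k ≥ 1`: for `labelMeasure`-almost every label `U : E → [0,1]`
(i.i.d. uniform), any two vertices of the slab are joined by a path of edges of the wired minimal
spanning forest `𝔉_w(U) = wmsf (slabGraph 3 k) U`.  Users take `(h : NewmanTassionWu2017_thm24)`;
the discharge `NewmanTassionWu2017_thm24_holds` is NTW §4 (gluing lemma for invasion clusters,
Lemma 4.1, and the combinatorial Lemma 4.2) on top of Theorem 3.1.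
[cite: NewmanTassionWu2017, Theorem 2.4] -/
def NewmanTassionWu2017_thm24 : Prop :=
  ∀ k : ℕ, 1 ≤ k →
    ∀ᵐ U ∂(labelMeasure (slab 3 k)),
      ∀ x y : slab 3 k, (SimpleGraph.fromEdgeSet (wmsf (slabGraph 3 k) U)).Reachable x y

/-- NAMED FACT — **Newman–Tassion–Wu 2017, Theorem 2.4, paper-literal form** ("the minimal spanning
forest on `S_k`", justified on p. 5: "It follows from [AKN] and [BK] that the infinite cluster on `S_k`,
if it exists, is a.s. unique. Therefore on `S_k`, WMSF and FMSF coincide"): for every `k ≥ 1`, almost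
surely the wired and free minimal spanning forests of the labelled slab coincide and form a single
tree spanning `S_k`. [cite: NewmanTassionWu2017, Theorem 2.4 (with §2.1, Prop. 2.2)] -/
def NewmanTassionWu2017_thm24_free : Prop :=
  ∀ k : ℕ, 1 ≤ k →
    ∀ᵐ U ∂(labelMeasure (slab 3 k)),
      wmsf (slabGraph 3 k) U =
          Literature.Barriers.CriticalPhenomena.fmsf (slabGraph 3 k).edgeSet U ∧
        ∀ x y : slab 3 k, (SimpleGraph.fromEdgeSet (wmsf (slabGraph 3 k) U)).Reachable x y

/-- NAMED FACT — **Newman–Tassion–Wu 2017, §4 (what the proof of Theorem 2.4 establishes): the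
invasion clusters of any two vertices of a slab meet a.s.**  NTW §2.4: "By Proposition 2.3, it
suffices to prove that for any `x ∈ S_k`, `𝓘_0 ∩ 𝓘_x ≠ ∅`"; §4 (after Lemma 4.1): "with probability
one, `𝓩_x^i` occurs for some `i > i₀`, which implies `V(Γ_min^{(i)}) ⊆ 𝓘_0 ∩ 𝓘_x`, and completes the
proof of Theorem 2.4."  Here, with the tree's vertex invasion (`Invasion.invadedRegion`, whose vertex
set is that of NTW's `𝓘_x` and `T_x`): for every `k ≥ 1` and every vertex `x` of `S_k`, for
`labelMeasure`-a.e. `U` the invaded regions of the origin and of `x` have a common vertex.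
[cite: NewmanTassionWu2017, §4 (proof of Theorem 2.4, pp. 19–21)] -/
def NewmanTassionWu2017_invasionMeet : Prop :=
  ∀ k : ℕ, 1 ≤ k → ∀ x : slab 3 k,
    ∀ᵐ U ∂(labelMeasure (slab 3 k)),
      (Invasion.invadedRegion (slabGraph 3 k) U (slabOrigin 3 k) ∩
        Invasion.invadedRegion (slabGraph 3 k) U x).Nonempty

end Literature.Probability.Percolation
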